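import Summits.QuantumFields.BalabanUV.Beta.EriceRemainderEnclosureHistoryAutonomyComparisonDualDeep
import Summits.QuantumFields.BalabanUV.Beta.EriceRemainderEnclosureHistoryAutonomyComparisonIsotoneExcess

/-!
# EriceRemainderEnclosureHistoryAutonomyComparisonDualComparison — (E135) **COMPARISON AT ANY SIZE FOR EVERY ISOTONE EXCESS OVER THE AFFINE BASE: conjecture (E58′) of
# the comparison column for isotone excesses, the lattice theorem (D‴).**  `B u = β₀ + Σ_{k<K} L_k·u_k` on the box ]0,γ] (`β₀ > 0`, `L ≥ 0`; the profile, the range `K`, the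
# Markov weight `L_0` and ALL SIZES ARBITRARY), `B′ ≥ B` with a zeroth moment and the excess `E = B′ − B` ISOTONE — NO modulus, steepness, size or relative-size condition on
# `E`.  **`le_of_isotone_excess_affine`**: ANY box solutions `h` of `B`, `h′` of `B′` from one pin satisfy `h′ ≤ h` at EVERY scale.  This is (E124) `le_of_isotone_excess_level`
# WITHOUT `hlev` and WITHOUT `hL0`, (E118e) `le_of_const_excess` for every isotone excess, (E49k) `le_of_isotone_excess` without the threshold `M·γ ≤ 3√3·b`.
#
# THE PROOF (DUAL ORBIT GAUGE, (E132)–(E135a); README `HOME/b2b-balaban-beta-d4-p2/g104/README.md`).  One perturbed orbit `h′`, the base restarted at each of its points,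
# dual steps `X′_m = B′(tail_{m+1}h′) − B(tail_1 S h′_m)`, gauge `g_m = X′_m·h′_m²`.  ROW INDUCTION from the deep region upward on `P(n)`: «`X′_m ≥ 0` and `g_{m+1} ≤ g_m` for all
# `m ≥ n`».  DEPTH (**`exists_depth`**): deep along `h′` the pins lie in a box below (E49k)'s closed threshold, where the tail orbit compares with the base restarted at its pin
# (`le_of_isotone_excess` read in ]0,γ′]) — `X′ ≥ 0` outright; and `K·(Σ L_k)·h′³ ≤ 1`.  BASE of the induction ((E135a) `deep_step`): with `X′ ≥ 0` known from the row on, the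
# window is read through the SOURCE (`δ_k ≤ k·E_{n+1}`, the excess antitone along the orbit) and `E_{n+1} ≤ 2X′_{n+1}` at a deep pin; cost ≤ 1 per unit share
# ((E135a) `gauge_of_row`).  STEP: (E134) `gauge_step`.  END: `X′ ≥ 0` everywhere ⟹ `h′ ≤ S p` row by row ((E132) `cmp_of_dual_steps_nonneg`).  Nothing about the excess is used
# beyond `E ≥ 0` and its isotonicity along ONE orbit — exactly the continuum's `e ≥ 0`, `e′ ≤ 0`.

Cell `pub-balaban`, β-function sub-cell, BINDER row D4 «RemainderConst leaves for Bałaban's split» (`HOME/BINDER-OWNERS.md`; owner lineage `b2b-balaban-beta-an4`;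
this file by co-owner #2 lineage `b2b-balaban-beta-d4-p2`, generation 104), β-FLOW TEAM duty (1), FREEZE (0) honoured (def-free; imports (E135a) `…ComparisonDualDeep` and
(E49k) `…ComparisonIsotoneExcess`; uses (E133) `coupling_gap_le` ∕ `dual_two_pin_le` ∕ `dual_row_ge`, (E134) `steps_mul_le_rise` ∕ `cmp_from_pin` ∕ `step_le_excess` ∕
`gauge_step`, (E135a) `deep_step`, (E132) `dual_step_eq_drop` ∕ `dual_gap_le_sum_steps` ∕ `cmp_of_dual_steps_nonneg`, (E49k) `le_of_isotone_excess`, (E49j)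
`seqBox_mono`, (E38a) `three_sqrt_three_pos`, (E39) `exists_memFlow_zm`, (E43b) `memFlow_unique_of_monotone_zm`, (E48a) `family_zero` ∕ `le_pin_of_memFlow` ∕
`strictAnti_of_memFlow` BY NAME; nothing restated).

HONEST FRAMING (page 1, verbatim and binding).  *"Discharging BetaPertH makes Bałaban's UV stability UNCONDITIONAL — a real constructive-QFT result; it is
NOT the continuum limit and NOT the Clay problem."*  THIS FILE DISCHARGES NOTHING OF THE KIND.  Elementary real analysis about ABSTRACT functionals on a box
]0,γ]^ℕ with displayed floor, profile and signs — hypotheses of a census, not facts; the form, signs, ages and moments of Bałaban's (1.22) limit functional (in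
particular whether its perturbations are isotone excesses over an affine profile) are NOT PRINTED ([I] p. 298; GAPS G-t4-U2-1∕-2) and NOT asserted.  Row D4 class
UNCHANGED (critical-path width 0; instance 0∕1; D4 DISCHARGE NO DATE).  HONEST DEPENDENCY: continuum YM on T⁴ ⇐ BetaPertH ∧ nine spine estimates (0/9 proved);
BetaPertH ⇐ (D1) ∧ (D4) ∧ CAP+tail; G-an2-4 gates asym, D1 and NE2/3/4.  NOT B12 Thm 2, NOT BetaPertH, NOT continuum, NOT Clay.

WHAT IS PROVED ([folklore]; 0 `def`, 0 sorry).  §1 `level_ge_floor`, **`exists_depth`**.  §2 **`dual_steps_nonneg_gauge`**.  §3 **`le_of_isotone_excess_affine`**.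
-/

noncomputable section
open Finset Set

namespace Summit.QuantumFields.BalabanUV.Beta.EriceRemainderEnclosureHistoryAutonomyComparisonDualComparison

open Literature.MathematicalPhysics.QuantumFieldTheory.Balaban1983to89
open Literature.MathematicalPhysics.QuantumFieldTheory.Balaban1983to89.T4BetaStationary
open Literature.MathematicalPhysics.QuantumFieldTheory.Balaban1983to89.T4BetaFlowWellPosed
open Summit.QuantumFields.BalabanUV.Beta.EriceRemainderEnclosureHistoryAutonomyOrder
  (family_zero family_mem family_tail_eq family_succ_eq le_of_pin_le strictAnti_of_memFlow le_pin_of_memFlow)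
open Summit.QuantumFields.BalabanUV.Beta.EriceRemainderEnclosureHistoryAutonomyComparisonDualOrbit
  (dual_step_eq_drop dual_source_antitone dual_gap_le_sum_steps cmp_of_dual_steps_nonneg)
open Summit.QuantumFields.BalabanUV.Beta.EriceRemainderEnclosureHistoryAutonomyComparisonDualRow
  (coupling_gap_le dual_two_pin_le dual_row_ge)
open Summit.QuantumFields.BalabanUV.Beta.EriceRemainderEnclosureHistoryAutonomyComparisonDualGauge
  (steps_mul_le_rise cmp_from_pin step_le_excess source_chain pert_step_le_level gauge_step)

open Summit.QuantumFields.BalabanUV.Beta.EriceRemainderEnclosureHistoryAutonomyComparisonDualDeep (deep_step)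

variable {B B' : (ℕ → ℝ) → ℝ} {M γ b β₀ : ℝ} {L : ℕ → ℝ} {K : ℕ} {S : ℝ → ℕ → ℝ} {h' : ℕ → ℝ}

/-! ## §1 The depth: small pins compare ((E49k)) and are deep -/

open Summit.QuantumFields.BalabanUV.Beta.EriceRemainderEnclosureHistoryAutonomyComparisonExcess (seqBox_mono)
open Summit.QuantumFields.BalabanUV.Beta.EriceRemainderEnclosureHistoryAutonomyComparisonIsotoneExcess (le_of_isotone_excess)
open Summit.QuantumFields.BalabanUV.Beta.EriceRemainderEnclosureHistoryAutonomyThreshold (three_sqrt_three_pos)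

/-- The levels of a box solution of a functional with floor `b′` grow at least linearly: `m·b′ ≤ 1∕h′_m²`. [folklore] -/
theorem level_ge_floor {b' : ℝ} (hb' : 0 < b') (hlo' : ∀ u, SeqBox γ u → b' ≤ B' u) (hh' : SeqBox γ h') {y : ℝ} (hf' : MemFlow B' y h') :
    ∀ m : ℕ, (m : ℝ) * b' ≤ 1 / h' m ^ 2
  | 0 => by have := (hh' 0).1; simp only [Nat.cast_zero, zero_mul]; positivity
  | m + 1 => by
    have ih := level_ge_floor hb' hlo' hh' hf' m
    rw [hf'.2 m]; push_cast
    linarith [hlo' _ (seqBox_shift hh' (m + 1))]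

/-- **THE DEPTH OF THE DUAL INDUCTION.**  Base `B` isotone with modulus `M`, floor `b > 0`; `B′ ≥ B` with a modulus and ISOTONE excess; `h′` a box solution of `B′`.  Deep
enough along `h′` (i) the pins are below the closed threshold `M·γ′ ≤ 3√3·b` of (E49k), so the orbit compares with the base restarted at its own points there
(`le_of_isotone_excess` in the box ]0,γ′]) — the dual steps are NON-NEGATIVE; (ii) any prescribed `C₀·h′_{m+1}³ ≤ 1` holds (levels grow linearly, `level_ge_floor`). [folklore] -/
theorem exists_depth {M' C₀ : ℝ} (hb : 0 < b)
    (hmono : ∀ u v : ℕ → ℝ, SeqBox γ u → SeqBox γ v → (∀ i, u i ≤ v i) → B u ≤ B v)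
    (hB : ∀ u u' : ℕ → ℝ, SeqBox γ u → SeqBox γ u' → ∀ D : ℝ, (∀ j, |u j - u' j| ≤ D) → |B u - B u'| ≤ M * D) (hM : 0 ≤ M)
    (hlo : ∀ u, SeqBox γ u → b ≤ B u)
    (hS : ∀ p, 0 < p → p ≤ γ → SeqBox γ (S p) ∧ MemFlow B p (S p))
    (hB' : ∀ u u' : ℕ → ℝ, SeqBox γ u → SeqBox γ u' → ∀ D : ℝ, (∀ j, |u j - u' j| ≤ D) → |B' u - B' u'| ≤ M' * D) (hM' : 0 ≤ M')
    (hexc : ∀ u, SeqBox γ u → B u ≤ B' u)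
    (hDmono : ∀ u v : ℕ → ℝ, SeqBox γ u → SeqBox γ v → (∀ i, u i ≤ v i) → B' u - B u ≤ B' v - B v)
    (hh' : SeqBox γ h') {y : ℝ} (hf' : MemFlow B' y h') (hC₀ : 0 ≤ C₀) :
    ∃ N : ℕ, ∀ m, N ≤ m → C₀ * h' (m + 1) ^ 3 ≤ 1 ∧ 0 ≤ B' (fun i => h' (m + 1 + i)) - B (fun i => S (h' m) (1 + i)) := by
  have hlo' : ∀ u, SeqBox γ u → b ≤ B' u := fun u hu => (hlo u hu).trans (hexc u hu)
  have hanti : Antitone h' := (strictAnti_of_memFlow hb hlo' hh' hf').antitone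
  have hpos : ∀ j, 0 < h' j := fun j => (hh' j).1
  have hγ : 0 < γ := (hh' 0).1.trans_le (hh' 0).2
  have hlev := level_ge_floor hb hlo' hh' hf'
  -- the small box
  have h33 : 0 < 3 * Real.sqrt 3 := three_sqrt_three_pos
  set γ' : ℝ := min γ (3 * Real.sqrt 3 * b / (M + 1)) with hγ'
  have hγ'0 : 0 < γ' := lt_min hγ (by positivity)
  have hγ'γ : γ' ≤ γ := min_le_left _ _
  have hsmall : M * γ' ≤ 3 * Real.sqrt 3 * b := by
    have h1 : M * γ' ≤ M * (3 * Real.sqrt 3 * b / (M + 1)) := mul_le_mul_of_nonneg_left (min_le_right _ _) hM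
    have h2 : M * (3 * Real.sqrt 3 * b / (M + 1)) ≤ 3 * Real.sqrt 3 * b := by
      rw [mul_div_assoc', div_le_iff₀ (by positivity)]; nlinarith [h33, hb]
    exact h1.trans h2
  -- the two depths
  obtain ⟨N₁, hN₁⟩ := exists_nat_ge (C₀ * γ / b)
  obtain ⟨N₂, hN₂⟩ := exists_nat_ge (1 / (b * γ' ^ 2))
  refine ⟨max N₁ N₂ + 1, fun m hm => ⟨?_, ?_⟩⟩
  · -- C₀ h′_{m+1}³ ≤ C₀ γ h′_{m+1}² ≤ C₀ γ ∕ ((m+1) b) ≤ 1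
    have hm1 : (N₁ : ℝ) + 1 ≤ (m : ℝ) + 1 := by
      have : N₁ + 1 ≤ m + 1 := by omega
      exact_mod_cast this
    have hl := hlev (m + 1)
    push_cast at hl
    have hq : 0 < ((m : ℝ) + 1) * b := by positivity
    have hsq : h' (m + 1) ^ 2 ≤ 1 / (((m : ℝ) + 1) * b) := by
      rw [le_div_iff₀ hq]
      have := mul_le_mul_of_nonneg_left hl (pow_pos (hpos (m + 1)) 2).le
      rw [mul_one_div_cancel (pow_pos (hpos (m + 1)) 2).ne'] at this
      linarith
    have hcube : h' (m + 1) ^ 3 ≤ γ * h' (m + 1) ^ 2 := by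
      have := (hh' (m + 1)).2; nlinarith [pow_pos (hpos (m + 1)) 2]
    have h1 : C₀ * h' (m + 1) ^ 3 ≤ C₀ * γ * (1 / (((m : ℝ) + 1) * b)) := by
      calc C₀ * h' (m + 1) ^ 3 ≤ C₀ * (γ * h' (m + 1) ^ 2) := mul_le_mul_of_nonneg_left hcube hC₀
        _ ≤ C₀ * (γ * (1 / (((m : ℝ) + 1) * b))) := mul_le_mul_of_nonneg_left (mul_le_mul_of_nonneg_left hsq hγ.le) hC₀
        _ = C₀ * γ * (1 / (((m : ℝ) + 1) * b)) := by ring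
    refine h1.trans ?_
    rw [mul_one_div, div_le_one hq]
    have : C₀ * γ / b ≤ (m : ℝ) + 1 := hN₁.trans (by linarith)
    rwa [div_le_iff₀ hb] at this
  · -- the pin h′_m lies in the small box, where (E49k) compares the tail orbit with the base restarted at h′_m
    have hm2 : (N₂ : ℝ) + 1 ≤ (m : ℝ) := by
      have : N₂ + 1 ≤ m := by omega
      exact_mod_cast this
    have hl := hlev m
    have hmγ' : h' m ≤ γ' := by
      -- 1/h′_m² ≥ m b ≥ 1/γ′²
      have h1 : 1 / γ' ^ 2 ≤ (m : ℝ) * b := by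
        have : 1 / (b * γ' ^ 2) ≤ (m : ℝ) := hN₂.trans (by linarith)
        rw [div_le_iff₀ (by positivity)] at this
        rw [div_le_iff₀ (by positivity)]; linarith
      exact (pow_le_pow_iff_left₀ (hpos m).le hγ'0.le two_ne_zero).mp
        ((one_div_le_one_div (pow_pos hγ'0 2) (pow_pos (hpos m) 2)).mp (h1.trans hl))
    have hpm := hh' m
    have hSm := hS (h' m) hpm.1 hpm.2
    -- hypotheses in the small box
    have hmonoR : ∀ u v : ℕ → ℝ, SeqBox γ' u → SeqBox γ' v → (∀ i, u i ≤ v i) → B u ≤ B v :=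
      fun u v hu hv hle => hmono u v (seqBox_mono hγ'γ hu) (seqBox_mono hγ'γ hv) hle
    have hBR : ∀ u u' : ℕ → ℝ, SeqBox γ' u → SeqBox γ' u' → ∀ D : ℝ, (∀ j, |u j - u' j| ≤ D) → |B u - B u'| ≤ M * D :=
      fun u u' hu hu' D hD => hB u u' (seqBox_mono hγ'γ hu) (seqBox_mono hγ'γ hu') D hD
    have hloR : ∀ u, SeqBox γ' u → b ≤ B u := fun u hu => hlo u (seqBox_mono hγ'γ hu)
    have hB'R : ∀ u u' : ℕ → ℝ, SeqBox γ' u → SeqBox γ' u' → ∀ D : ℝ, (∀ j, |u j - u' j| ≤ D) → |B' u - B' u'| ≤ M' * D :=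
      fun u u' hu hu' D hD => hB' u u' (seqBox_mono hγ'γ hu) (seqBox_mono hγ'γ hu') D hD
    have hexcR : ∀ u, SeqBox γ' u → B u ≤ B' u := fun u hu => hexc u (seqBox_mono hγ'γ hu)
    have hDmonoR : ∀ u v : ℕ → ℝ, SeqBox γ' u → SeqBox γ' v → (∀ i, u i ≤ v i) → B' u - B u ≤ B' v - B v :=
      fun u v hu hv hle => hDmono u v (seqBox_mono hγ'γ hu) (seqBox_mono hγ'γ hv) hle
    -- the two orbits from the pin h′_m, in the small box
    have hhR : SeqBox γ' (S (h' m)) := fun j => ⟨(hSm.1 j).1, (le_pin_of_memFlow hb hlo hSm.1 hSm.2 j).trans hmγ'⟩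
    have hh'R : SeqBox γ' (fun i => h' (m + i)) := fun i => ⟨hpos _, (hanti (Nat.le_add_right m i)).trans hmγ'⟩
    have hf'R : MemFlow B' (h' m) (fun i => h' (m + i)) := by
      refine ⟨by simp, fun q => ?_⟩
      have := hf'.2 (m + q)
      simpa [Nat.add_assoc] using this
    have hcmp1 : h' (m + 1) ≤ S (h' m) 1 :=
      le_of_isotone_excess hmonoR hBR hM hb hloR hsmall hB'R hM' hexcR hDmonoR hpm.1 hmγ' hhR hSm.2 hh'R hf'R 1
    -- in level form this is X′_m ≥ 0
    have e1 : 1 / h' (m + 1) ^ 2 = 1 / h' m ^ 2 + B' (fun i => h' (m + 1 + i)) := hf'.2 m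
    have e2 : 1 / S (h' m) (0 + 1) ^ 2 = 1 / S (h' m) 0 ^ 2 + B (fun i => S (h' m) (0 + 1 + i)) := hSm.2.2 0
    rw [family_zero hS hpm.1 hpm.2] at e2
    have e3 : (fun i => S (h' m) (0 + 1 + i)) = (fun i => S (h' m) (1 + i)) := by funext i; simp
    rw [e3] at e2; simp only [Nat.zero_add] at e2
    have hlevle : 1 / S (h' m) 1 ^ 2 ≤ 1 / h' (m + 1) ^ 2 :=
      one_div_le_one_div_of_le (pow_pos (hpos _) 2) (pow_le_pow_left₀ (hpos _).le hcmp1 2)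
    linarith

/-! ## §2 The dual row induction: every dual step is non-negative and the gauge never increases going up -/

/-- **THE DUAL LEVEL GAUGE ALONG EVERY PERTURBED ORBIT.**  Affine base `B u = β₀ + Σ_{k<K} L_k·u_k` (`β₀ > 0`, `L ≥ 0`, `L_0` free; floor `b`, modulus `M`, unique box solutions
`S p`), `B′ ≥ B` with a modulus and ISOTONE excess, `h′` a box solution of `B′`.  Then at EVERY row `m`: `X′_m ≥ 0` and `X′_{m+1}·h′_{m+1}² ≤ X′_m·h′_m²` — induction from
the depth of `exists_depth` (there: `X′ ≥ 0` by (E49k), the gauge by `deep_step`) upward by (E134) `gauge_step`. [folklore] -/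
theorem dual_steps_nonneg_gauge {M' : ℝ} (hBaff : ∀ u, SeqBox γ u → B u = β₀ + ∑ k ∈ range K, L k * u k) (hβ : 0 < β₀) (hL : ∀ k, 0 ≤ L k)
    (hb : 0 < b)
    (hmono : ∀ u v : ℕ → ℝ, SeqBox γ u → SeqBox γ v → (∀ i, u i ≤ v i) → B u ≤ B v)
    (hB : ∀ u u' : ℕ → ℝ, SeqBox γ u → SeqBox γ u' → ∀ D : ℝ, (∀ j, |u j - u' j| ≤ D) → |B u - B u'| ≤ M * D) (hM : 0 ≤ M)
    (hlo : ∀ u, SeqBox γ u → b ≤ B u)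
    (hS : ∀ p, 0 < p → p ≤ γ → SeqBox γ (S p) ∧ MemFlow B p (S p))
    (huniq : ∀ p, 0 < p → p ≤ γ → ∀ u u' : ℕ → ℝ, SeqBox γ u → SeqBox γ u' → MemFlow B p u → MemFlow B p u' → u = u')
    (hB' : ∀ u u' : ℕ → ℝ, SeqBox γ u → SeqBox γ u' → ∀ D : ℝ, (∀ j, |u j - u' j| ≤ D) → |B' u - B' u'| ≤ M' * D) (hM' : 0 ≤ M')
    (hexc : ∀ u, SeqBox γ u → B u ≤ B' u)
    (hDmono : ∀ u v : ℕ → ℝ, SeqBox γ u → SeqBox γ v → (∀ i, u i ≤ v i) → B' u - B u ≤ B' v - B v)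
    (hh' : SeqBox γ h') {y : ℝ} (hf' : MemFlow B' y h') :
    ∀ m, 0 ≤ B' (fun i => h' (m + 1 + i)) - B (fun i => S (h' m) (1 + i))
      ∧ (B' (fun i => h' (m + 1 + 1 + i)) - B (fun i => S (h' (m + 1)) (1 + i))) * h' (m + 1) ^ 2
        ≤ (B' (fun i => h' (m + 1 + i)) - B (fun i => S (h' m) (1 + i))) * h' m ^ 2 := by
  have hC₀ : 0 ≤ (K : ℝ) * ∑ k ∈ range K, L k := mul_nonneg (Nat.cast_nonneg K) (sum_nonneg fun k _ => hL k)
  obtain ⟨N, hN⟩ := exists_depth (S := S) hb hmono hB hM hlo hS hB' hM' hexc hDmono hh' hf' hC₀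
  -- P(n): the conclusion at every m ≥ n; induction on the distance d = N − n
  have hP : ∀ d n, N ≤ n + d → ∀ m, n ≤ m → 0 ≤ B' (fun i => h' (m + 1 + i)) - B (fun i => S (h' m) (1 + i))
      ∧ (B' (fun i => h' (m + 1 + 1 + i)) - B (fun i => S (h' (m + 1)) (1 + i))) * h' (m + 1) ^ 2
        ≤ (B' (fun i => h' (m + 1 + i)) - B (fun i => S (h' m) (1 + i))) * h' m ^ 2 := by
    intro d
    induction d with
    | zero =>
      intro n hn m hm
      rw [add_zero] at hn
      have hXm := (hN m (hn.trans hm)).2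
      refine ⟨hXm, ?_⟩
      exact deep_step (B' := B') hBaff hβ hL hb hmono hB hM hlo hS huniq hexc hDmono hh' hf' m hXm
        (fun l => by
          have := (hN (m + 1 + l) (by omega)).2
          exact this)
        (by have := (hN m (hn.trans hm)).1; linarith)
    | succ d ih =>
      intro n hn m hm
      have ih' := ih (n + 1) (by omega)
      by_cases hm1 : n + 1 ≤ m
      · exact ih' m hm1
      · have hmn : m = n := by omega
        subst hmn
        exact gauge_step (B' := B') hBaff hβ hL hb hmono hB hM hlo hS huniq hexc hDmono hh' hf' m
          (fun l => (ih' (m + 1 + l) (by omega)).1) (fun m' hm' => (ih' m' hm').2)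
  intro m
  exact hP N 0 (by omega) m (Nat.zero_le m)

/-! ## §3 COMPARISON AT ANY SIZE FOR EVERY ISOTONE EXCESS OVER THE AFFINE BASE -/

/-- **CONJECTURE (E58′) FOR ISOTONE EXCESSES — THE LATTICE THEOREM (D‴), family-free form.**  `B u = β₀ + Σ_{k<K} L_k·u_k` on the box ]0,γ] with `β₀ > 0`, `L ≥ 0` — the
profile, the range `K`, the Markov weight `L_0` and ALL SIZES ARBITRARY; `B′ ≥ B` on the box with a zeroth moment `M′` and the excess `E = B′ − B` ISOTONE (non-decreasing
along ordered box configurations) — NO modulus, steepness, size or relative-size condition on `E`; `h`, `h′` ANY box solutions of `B`, `B′` from one pin `p ∈ ]0,γ]`.  Then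
`h′ ≤ h` at EVERY scale.  This is (E124) `le_of_isotone_excess_level` WITHOUT `hlev` and WITHOUT `hL0`, (E118e) `le_of_const_excess` for every isotone excess, and
(E49k) `le_of_isotone_excess` without the threshold: the lattice transcription of the continuum theorem (D‴) of `HOME/b2b-balaban-beta-d4-p2/g103/README.md` in the
DUAL ORBIT GAUGE ((E132)–(E135)).  Proof: (E39)∕(E43b) give the unique base family `S`; `dual_steps_nonneg_gauge` gives `X′ ≥ 0` along `h′`; (E132)
`cmp_of_dual_steps_nonneg`. [folklore] -/
theorem le_of_isotone_excess_affine {M' p : ℝ} {h : ℕ → ℝ} (hBaff : ∀ u, SeqBox γ u → B u = β₀ + ∑ k ∈ range K, L k * u k) (hL : ∀ k, 0 ≤ L k)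
    (hβ : 0 < β₀)
    (hB' : ∀ u u' : ℕ → ℝ, SeqBox γ u → SeqBox γ u' → ∀ D : ℝ, (∀ j, |u j - u' j| ≤ D) → |B' u - B' u'| ≤ M' * D) (hM' : 0 ≤ M')
    (hexc : ∀ u, SeqBox γ u → B u ≤ B' u)
    (hDmono : ∀ u v : ℕ → ℝ, SeqBox γ u → SeqBox γ v → (∀ j, u j ≤ v j) → B' u - B u ≤ B' v - B v)
    (hp : 0 < p) (hpγ : p ≤ γ) (hh : SeqBox γ h) (hf : MemFlow B p h) (hh' : SeqBox γ h') (hf' : MemFlow B' p h') (j : ℕ) :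
    h' j ≤ h j := by
  -- the affine base: isotone, floor β₀, zeroth moment Σ L_k
  have hmono : ∀ u v : ℕ → ℝ, SeqBox γ u → SeqBox γ v → (∀ i, u i ≤ v i) → B u ≤ B v := fun u v hu hv hle => by
    rw [hBaff u hu, hBaff v hv]
    exact add_le_add le_rfl (sum_le_sum fun k _ => mul_le_mul_of_nonneg_left (hle k) (hL k))
  have hlo : ∀ u, SeqBox γ u → β₀ ≤ B u := fun u hu => by
    rw [hBaff u hu]; exact le_add_of_nonneg_right (sum_nonneg fun k _ => mul_nonneg (hL k) (hu k).1.le)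
  have hBmod : ∀ u u' : ℕ → ℝ, SeqBox γ u → SeqBox γ u' → ∀ D : ℝ, (∀ j, |u j - u' j| ≤ D) → |B u - B u'| ≤ (∑ k ∈ range K, L k) * D := by
    intro u u' hu hu' D hD
    rw [hBaff u hu, hBaff u' hu', add_sub_add_left_eq_sub, ← sum_sub_distrib, sum_mul]
    refine (abs_sum_le_sum_abs _ _).trans (sum_le_sum fun k _ => ?_)
    rw [← mul_sub, abs_mul, abs_of_nonneg (hL k)]
    exact mul_le_mul_of_nonneg_left (hD k) (hL k)
  have hM : 0 ≤ ∑ k ∈ range K, L k := sum_nonneg fun k _ => hL k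
  -- the unique base family
  have hex : ∀ q : ℝ, 0 < q → q ≤ γ → ∃ k : ℕ → ℝ, SeqBox γ k ∧ MemFlow B q k :=
    fun q hq hqγ => Summit.QuantumFields.BalabanUV.Beta.EriceRemainderEnclosureHistoryAutonomyExistence.exists_memFlow_zm hBmod hM hq hqγ hβ hlo
  choose! S hSb hSf using hex
  have hS : ∀ q, 0 < q → q ≤ γ → SeqBox γ (S q) ∧ MemFlow B q (S q) := fun q hq hqγ => ⟨hSb q hq hqγ, hSf q hq hqγ⟩
  have huniq : ∀ q, 0 < q → q ≤ γ → ∀ u u' : ℕ → ℝ, SeqBox γ u → SeqBox γ u' → MemFlow B q u → MemFlow B q u' → u = u' :=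
    fun q hq _ u u' hu hu' hfu hfu' =>
      Summit.QuantumFields.BalabanUV.Beta.EriceRemainderEnclosureHistoryAutonomyMonotoneGeneral.memFlow_unique_of_monotone_zm hmono hBmod hM hq hβ hlo hu hu' hfu hfu'
  have e : h = S p := huniq p hp hpγ _ _ hh (hS p hp hpγ).1 hf (hS p hp hpγ).2
  -- every dual step along h′ is non-negative, hence comparison
  have hX := dual_steps_nonneg_gauge (B' := B') hBaff hβ hL hβ hmono hBmod hM hlo hS huniq hB' hM' hexc hDmono hh' hf'
  rw [e]
  exact cmp_of_dual_steps_nonneg (B' := B') hβ hBmod hM hlo hS huniq hp hpγ hh' hf' j (fun i _ => sub_nonneg.mp (hX i).1) j le_rfl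

end Summit.QuantumFields.BalabanUV.Beta.EriceRemainderEnclosureHistoryAutonomyComparisonDualComparison

end
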